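import Summits.BirchSwinnertonDyer.BirchSwinnertonDyer.Theorems.SchneiderFreeAdditiveX3PoitouTateMiddleExactTools
import Literature.NumberTheory.GaloisRepresentations.LocalTatePairingLevelChange
import HarnessLib

/-!
# Road «SUR-Λ» (crux 2 `GoodLatticeBDPValue`, by-name input #9 `Greenberg2016.prop263_sur_of_crk`),
# brick C2b for THE canonical invariants: the local Tate pairings of a tower are compatible in `ℚ/ℤ`

Cell `bsd-eis`, width seat `bsd-line-x1-p1-w2` (gen 10); helper for stmt-BirchSwinnertonDyer-19032
(`--supports`), road memo `SUR-LAMBDA-ROAD-w5g9.md` §7.4 C2b.  THEOREMS ONLY (no definition, no named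
fact, no `sorry`).

The Literature file `GaloisRepresentations/LocalTatePairingLevelChange.lean` proves, for finite discrete
`Γ_K`-modules `M` (killed by `n`) and `M'` (killed by `n'`), `n ∣ n'`, a `Γ_K`-equivariant `ι : M → M'`
and the dual transition `ι^* : Hom(M', μ_{n'}) → Hom(M, μ_n)` (`(μ_n ⊆ μ_{n'}) ((ι^* g) m) = g (ι m)`):
`ι_* a ∪_{n'} b' = (μ_n ⊆ μ_{n'})_* (a ∪_n (ι^*)_* b')` in `H²(K_v, μ_{n'})`, and its `ℤ/n'`- and
`ℚ/ℤ`-valued forms for any pair of additive maps `inv`, `inv'` obeying the level-change law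
`inv' ((μ_n ⊆ μ_{n'})_* z) = (n'/n) · inv z`.  Here that law is DISCHARGED for THE invariant maps
`LocalInvariants.canonical K n v` at EVERY place `v` by the X3 chain's
`PoitouTateReduction.canonical_map_muIncl` (Serre XIII §3 Cor. 3 on local classes), giving the form
the Λ-adic arguments consume (Greenberg 2010 §3.1 (9): the pairing `P(K,D) × P(K,T*) → ℚ_p/ℤ_p`
assembled from the finite levels `M_k = 𝐃[𝔪ᵏ]`):

* `localTatePairingZMod_canonical_map_eq` — `⟨ι_* a, b'⟩^{can}_{n'} = (n'/n) · ⟨a, (ι^*)_* b'⟩^{can}_n`;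
* `zmodToQmodZ_localTatePairingZMod_canonical_map_eq` — equality in `ℚ/ℤ`.

HONEST FRAMING: finite-level plumbing; closes no stub; no case of Poitou–Tate duality, of Greenberg's
Prop. 2.6.3 or of BSD is proved here; no summit statement is proved.
References: [NeukirchSchmidtWingberg2008] (1.4.2); [SerreLocalFields1979] XIII §3 Cor. 3;
[MilneADT2006] I Cor. 2.3; [Greenberg2010] §2 (5), §3.1 (9).
-/

set_option autoImplicit false
set_option linter.dupNamespace false

noncomputable section

open CategoryTheory Function NumberField IsDedekindDomain Field
open scoped NumberField ContRepresentation

universe u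

namespace Summit.BirchSwinnertonDyer.BirchSwinnertonDyer.Theorems.SurLambda

open Literature.NumberTheory.GaloisRepresentations Literature.NumberTheory.GaloisCohomology
open Literature.NumberTheory.GaloisRepresentations.DiscreteGaloisModule (mu MuCarrier TateDual tateDual
  localTatePairingZMod)
open Literature.AnabelianGeometry.AbsoluteAnabelian.Prop121vii (zmodToQmodZ)
open Summit.BirchSwinnertonDyer.BirchSwinnertonDyer.Theorems.SchneiderFreeAdditiveX3.PoitouTateReduction
  (canonical_map_muIncl)

variable {K : Type u} [Field K] [NumberField K]
  {M : Type u} [AddCommGroup M] [TopologicalSpace M] [DiscreteTopology M] [Finite M]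
  {M' : Type u} [AddCommGroup M'] [TopologicalSpace M'] [DiscreteTopology M'] [Finite M']
  (ρ : DiscreteGaloisModule K M) (ρ' : DiscreteGaloisModule K M') {n n' : ℕ} [NeZero n] [NeZero n']

/-- **`⟨ι_* a, b'⟩^{can}_{n'} = (n'/n) · ⟨a, (ι^*)_* b'⟩^{can}_n` in `ℤ/n'`** for THE canonical local
invariant maps at every place `v` of the number field `K` (finite levels `n ∣ n'` of a tower; `ι`,
`ι^*`, `μ_n ⊆ μ_{n'}` consumed through their values). [cite: NeukirchSchmidtWingberg2008, I §4 Prop. (1.4.2)]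
[cite: SerreLocalFields1979, XIII §3 Cor. 3] [cite: MilneADT2006, Ch. I, Cor. 2.3] -/
theorem localTatePairingZMod_canonical_map_eq (hnn' : n ∣ n')
    (ι : ρ.toContRepresentation →ⁱL ρ'.toContRepresentation)
    (red : (ρ'.tateDual n').toContRepresentation →ⁱL (ρ.tateDual n).toContRepresentation)
    (hred : ∀ (g : TateDual K M' n') (m : M), muInclusion K hnn' (red g m) = g (ι m))
    (j : (mu K n).toContRepresentation →ⁱL (mu K n').toContRepresentation)
    (hj : ∀ ζ : MuCarrier K n, j ζ = muInclusion K hnn' ζ) (v : Place K)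
    (a : galoisCohomology (ρ.toLocal v) 1) (b' : galoisCohomology ((ρ'.tateDual n').toLocal v) 1) :
    localTatePairingZMod ρ' n' v (LocalInvariants.canonical K n' v)
        (galoisCohomology.map (ι.restrictField (Place.Completion v)) 1 a) b' =
      (((localTatePairingZMod ρ n v (LocalInvariants.canonical K n v) a
          (galoisCohomology.map (red.restrictField (Place.Completion v)) 1 b')).val * (n' / n) : ℕ) :
        ZMod n') :=
  localTatePairingZMod_map_eq_of_levelChange ρ ρ' hnn' ι red hred j hj v _ _
    (canonical_map_muIncl hnn' j hj v) a b'

/-- **The canonical local Tate pairings of a tower are compatible in `ℚ/ℤ`**: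
`⟨ι_* a, b'⟩^{can}_{n'} / n' = ⟨a, (ι^*)_* b'⟩^{can}_n / n`. [cite: Greenberg2010, §3.1 (9)]
[cite: NeukirchSchmidtWingberg2008, I §4 Prop. (1.4.2)] [cite: SerreLocalFields1979, XIII §3 Cor. 3] -/
theorem zmodToQmodZ_localTatePairingZMod_canonical_map_eq (hnn' : n ∣ n')
    (ι : ρ.toContRepresentation →ⁱL ρ'.toContRepresentation)
    (red : (ρ'.tateDual n').toContRepresentation →ⁱL (ρ.tateDual n).toContRepresentation)
    (hred : ∀ (g : TateDual K M' n') (m : M), muInclusion K hnn' (red g m) = g (ι m))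
    (j : (mu K n).toContRepresentation →ⁱL (mu K n').toContRepresentation)
    (hj : ∀ ζ : MuCarrier K n, j ζ = muInclusion K hnn' ζ) (v : Place K)
    (a : galoisCohomology (ρ.toLocal v) 1) (b' : galoisCohomology ((ρ'.tateDual n').toLocal v) 1) :
    zmodToQmodZ n' (localTatePairingZMod ρ' n' v (LocalInvariants.canonical K n' v)
        (galoisCohomology.map (ι.restrictField (Place.Completion v)) 1 a) b') =
      zmodToQmodZ n (localTatePairingZMod ρ n v (LocalInvariants.canonical K n v) a
        (galoisCohomology.map (red.restrictField (Place.Completion v)) 1 b')) :=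
  zmodToQmodZ_localTatePairingZMod_map_eq_of_levelChange ρ ρ' hnn' ι red hred j hj v _ _
    (canonical_map_muIncl hnn' j hj v) a b'

end Summit.BirchSwinnertonDyer.BirchSwinnertonDyer.Theorems.SurLambda

end
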